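import Mathlib
import Literature.MathematicalPhysics.QuantumFieldTheory.MagnenRivasseauSeneor1993.MRS93OneLoopCounterterms
import HarnessLib

/-!
# Magnen–Rivasseau–Sénéor, *Construction of YM₄ with an infrared cutoff* (CMP 155, 1993), §III — the gauge-restoring counterterms
# (III.1) and the STATEMENT of LEMMA III.1 (III.2) AS PRINTED (its one-loop arithmetic is the tree's `MRS93OneLoopCounterterms.lean`)

statement-level skeleton of published theorems with citation tags; proofs where landed; nothing here is a claim about the
Yang–Mills mass gap, about continuum YM₄ on T⁴, or about the Clay problem

**Citation header (reproduction of PUBLISHED work).** J. Magnen, V. Rivasseau, R. Sénéor, *Construction of YM₄ with an infrared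
cutoff*, Commun. Math. Phys. **155** (1993) 325–383 [MagnenRivasseauSeneor1993], Sect. III «Computation of the Counterterms due to the
Ultraviolet Cutoff», pp. 347–352. Loci «p.NNN [PDF nn] tl.k» = journal page, PDF page (= journal page − 324), text-layer line of the held
Project-Euclid scan `paper:magnen1993-cmp155-mrs-ym4-infrared-cutoff` (PDF sha256 fa4ddac3…); the displays (III.1), (III.2) were read on
the page images `run/shared/lean/pub/lit-balaban/inprint/lit-balaban-p14/renders-cmp155/p23_full_s6.png`, `p24_full_s6.png` (the text
layer keeps of (III.2) only «e_ρ = eλ⁴»). Cell pub-balaban-gaps (YM blitz, track G3), seat mrs-lit-2; companion record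
`run/shared/lean/pub/pub-balaban-gaps/g3/MRS-AS-PRINTED-estimates.md`. The one-loop ARITHMETIC of the lemma's proof (graphs G₁–G₄,
G′₁–G′₃, the plateau of (II.14), (III.4)–(III.7), the sign analysis) is kernel-checked in the tree file `MRS93OneLoopCounterterms.lean`
(namespace `…MagnenRivasseauSeneor1993.OneLoop`), which explicitly left the STATEMENT (III.2) untyped («What is NOT claimed: Lemma III.1's
values (III.2) … the display is not legible in the held text layer»); this file supplies it from the page image and imports that file.

**Grade of record (lit-balaban YM-INPRINT.md row D1).** Lemma III.1: **PROOF** (p.348 tl.9 «Proof.» – p.352 tl.17; one-loop computation;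
p.348 tl.22–23 «The other ones [c, d, e] are less interesting and left to the reader»). p.347 tl.13–15: «The main result on the stability
of certain types of cutoffs was derived with [Feldman] around 1986; there is also an exposition of this result in [S] and [R].»

**What the paper prints (verbatim; displays from the page images).**
* p.347 [PDF 23] tl.21–26: «Therefore the only new relevant or marginal operators that we should consider are − Tr A_μA_μ, (− Tr A_μA_μ)²,
  (− Tr A_μ(−Δ)A_μ) and − Tr(∂_μA_μ)² which we abbreviate respectively as A², A⁴, A(−Δ)A and (∂A)² (recall the convention that traces are
  definite negative). This is only true for the SU(2) theory, for an SU(N) theory there would be a longer list of operators to consider and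
  the analysis would be more complicated.» tl.29–32: «To correct this problem, using the possibility of rescaling A, we need only to
  introduce a single counterterm, for instance of the type F₄. Therefore the counterterms that we introduce are:»
  **(III.1)**: «e^{CT} = e^{−a_ρ∫_Λ(A⁴/4!) − b_ρ∫_Λ(A²/2!) − c_ρ∫_Λ(A(−Δ)A) − d_ρ∫_Λ(∂A)² − e_ρ∫_Λ F₄}.»
  tl.36–38: «The relevant counterterm b_ρ∫_Λ(A²/2) must be fine tuned exactly to have a renormalized mass which is zero.»
* p.347 tl.41 – p.348 [PDF 24] tl.4: «For the marginal counterterms, an analysis to lowest order in perturbation theory is in fact enough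
  for our purpose (because of asymptotic freedom, further orders again should give no contributions to finite scales in the limit ρ → ∞).
  We obtain:» **Lemma III.1** (III.2) (page image): «a_ρ ≅ aλ_ρ⁴, b_ρ ≅ bM^{2ρ}λ_ρ², c_ρ ≅ cλ_ρ², d_ρ ≅ dλ_ρ², e_ρ ≅ eλ_ρ⁴. (III.2)
  Furthermore by choosing the cutoff of the form (II.14) with η small enough (depending on the shape of τ), the coefficient a is strictly
  positive⁵.» Footnote 5 p.348: «It is not clear whether a cutoff for which a would be negative (or zero) is strictly forbidden for a
  constructive analysis. …»
* (III.6)–(III.7) p.352 [PDF 28] tl.2–15 (for the positivity clause): the one-loop (A⁴/24) contribution is «9/8(1 + (1/ζ − 1)/2 +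
  5/12(1/ζ − 1)²)|ln η| + finite terms, where "finite terms" now means terms which are uniformly bounded both as ρ tends to +∞ and η
  tends to 0 … taking η small enough … we can always achieve our goal of a positive total A⁴ contribution».

**What is typed / proved here (zero `sorry`; zero closed named facts — the `def … : Prop` are predicates on explicit data).**
* §1 `CountertermFamily` — the data of (III.1): the bare coupling `λ_ρ` and the five coefficients `a_ρ, …, e_ρ`, indexed by the cutoff
  index `ρ` (scale `M^ρ`); `LemmaIII1ScalingPrinted` — (III.2) read as ASYMPTOTIC EQUALITY («≅», the paper's sign for «equal at the order
  considered», cf. «≅_{β→0}» in (VI.18)): the ratios `a_ρ/λ_ρ⁴`, `b_ρ/(M^{2ρ}λ_ρ²)`, `c_ρ/λ_ρ²`, `d_ρ/λ_ρ²`, `e_ρ/λ_ρ⁴` converge as `ρ → ∞`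
  to constants `a, b, c, d, e`; `LemmaIII1PositivityPrinted` — the second sentence: the leading coefficient `a = a(η)` (a function of the
  cutoff parameter `η` of (II.14), at fixed shape `τ` and gauge `ζ`) is `> 0` for all sufficiently small `η`.
* §2 `oneLoopA4Coeff` — the one-loop value of `a(η)` in the units of (III.6): `lnEtaCoeff(t)·|ln η| + F(η)` with `t = 1/ζ − 1` and
  `F` the «finite terms»; `oneLoopA4Coeff_pos` — it is `> 0` whenever `|F(η)| ≤ C` and `0 < η ≤ exp(−160C/73)`, `η < 1` (from the tree's
  `OneLoop.stabilizing_coefficient_ge_half_log`: it is even `≥ ½|ln η|`); `positivity_of_boundedFiniteTerms` — HENCE the printed positivity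
  clause `LemmaIII1PositivityPrinted (oneLoopA4Coeff t F)` holds as soon as the finite terms are bounded by some `C` on some `(0, η₁]`
  (exactly the paper's «uniformly bounded … as η tends to 0»), with the explicit threshold `η₀ = min(η₁, ½, exp(−160C/73))`.

**Readings (declared).** (i) «≅» typed as convergence of ratios (`Filter.Tendsto … atTop (𝓝 ·)`); the exact-equality reading («a_ρ =
aλ_ρ⁴ at one loop») is the special case of constant ratios. (ii) The positivity clause is typed on the leading coefficient as a function
of `η` alone; its dependence «on the shape of τ» and on `ζ` is through the finite terms `F` and `t = 1/ζ − 1`, which are parameters.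
(iii) `λ` is a Lean keyword: the bare coupling is spelled `lamB`.

**What is NOT claimed.** The Feynman rules, the graphs, the value of the finite terms, the coefficients `b, c, d, e`, the fine tuning of
`b_ρ` (a fixed-point problem «as in [R]», not done in print), the Slavnov identities the counterterms restore — none is formalised here;
nor is (III.2) PROVED (it is a typed predicate). Nothing here bears on Bałaban's papers.
-/

noncomputable section

open Real Filter Topology

namespace Literature.MathematicalPhysics.QuantumFieldTheory.MagnenRivasseauSeneor1993

namespace Counterterms

/-! ## §1 (III.1) data and Lemma III.1 (III.2) as typed predicates -/

/-- The data of the gauge-restoring counterterms **(III.1)** p.347 [PDF 23]: «e^{CT} = e^{−a_ρ∫_Λ(A⁴/4!) − b_ρ∫_Λ(A²/2!) −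
c_ρ∫_Λ(A(−Δ)A) − d_ρ∫_Λ(∂A)² − e_ρ∫_Λ F₄}», indexed by the ultraviolet cutoff index `ρ` (cutoff scale `M^ρ`, p.330), together with the
bare coupling `λ_ρ` of the ansatz (II.11) (mrs-lit-1's statement layer; abstract data here). Only the COEFFICIENTS are carried — the
operators `A⁴, A², A(−Δ)A, (∂A)², F₄` belong to the statement layer. [cite: MagnenRivasseauSeneor1993, §III (III.1) p.347] -/
structure CountertermFamily where
  /-- the bare coupling `λ_ρ` at cutoff index `ρ` ((II.11)) -/
  lamB : ℕ → ℝ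
  /-- `a_ρ`, coefficient of `−∫_Λ A⁴/4!` -/
  a : ℕ → ℝ
  /-- `b_ρ`, coefficient of `−∫_Λ A²/2!` -/
  b : ℕ → ℝ
  /-- `c_ρ`, coefficient of `−∫_Λ A(−Δ)A` -/
  c : ℕ → ℝ
  /-- `d_ρ`, coefficient of `−∫_Λ (∂A)²` -/
  d : ℕ → ℝ
  /-- `e_ρ`, coefficient of `−∫_Λ F₄` -/
  e : ℕ → ℝ

/-- **Lemma III.1, display (III.2)** p.348 [PDF 24] (page image `p24_full_s6.png`), verbatim: «a_ρ ≅ aλ_ρ⁴, b_ρ ≅ bM^{2ρ}λ_ρ², c_ρ ≅ cλ_ρ²,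
d_ρ ≅ dλ_ρ², e_ρ ≅ eλ_ρ⁴. (III.2)» — preceded by p.347 tl.41 – p.348 tl.4 «For the marginal counterterms, an analysis to lowest order in
perturbation theory is in fact enough for our purpose … We obtain:». Typed (reading (i)) as: there are constants `a, b, c, d, e` such that
`a_ρ/λ_ρ⁴ → a`, `b_ρ/(M^{2ρ}λ_ρ²) → b`, `c_ρ/λ_ρ² → c`, `d_ρ/λ_ρ² → d`, `e_ρ/λ_ρ⁴ → e` as `ρ → ∞` (`M` = the slicing ratio of (II.13)).
GRADE OF RECORD: PROOF (one loop; `c, d, e` «left to the reader»). A typed predicate, never a `theorem` here.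
[cite: MagnenRivasseauSeneor1993, §III Lemma III.1 (III.2) p.348] -/
def LemmaIII1ScalingPrinted (C : CountertermFamily) (M : ℝ) : Prop :=
  ∃ a b c d e : ℝ,
    Tendsto (fun ρ : ℕ => C.a ρ / C.lamB ρ ^ 4) atTop (𝓝 a) ∧
    Tendsto (fun ρ : ℕ => C.b ρ / (M ^ (2 * ρ) * C.lamB ρ ^ 2)) atTop (𝓝 b) ∧
    Tendsto (fun ρ : ℕ => C.c ρ / C.lamB ρ ^ 2) atTop (𝓝 c) ∧
    Tendsto (fun ρ : ℕ => C.d ρ / C.lamB ρ ^ 2) atTop (𝓝 d) ∧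
    Tendsto (fun ρ : ℕ => C.e ρ / C.lamB ρ ^ 4) atTop (𝓝 e)

/-- **Lemma III.1, second sentence** p.348 [PDF 24] tl.7–8, verbatim: «Furthermore by choosing the cutoff of the form (II.14) with η
small enough (depending on the shape of τ), the coefficient a is strictly positive⁵.» Typed on the leading `A⁴/4!` coefficient as a
function `aOf η` of the cutoff parameter `η` of (II.14) (shape `τ` and gauge fixed, reading (ii)): `∃ η₀ > 0, ∀ η ∈ (0, η₀], aOf η > 0`.
GRADE OF RECORD: PROOF ((III.4)–(III.7), pp.351–352). A typed predicate; §2 derives it for the one-loop value from the tree's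
kernel-checked (III.6). [cite: MagnenRivasseauSeneor1993, §III Lemma III.1 p.348] -/
def LemmaIII1PositivityPrinted (aOf : ℝ → ℝ) : Prop :=
  ∃ η₀ : ℝ, 0 < η₀ ∧ ∀ η : ℝ, 0 < η → η ≤ η₀ → 0 < aOf η

/-! ## §2 The positivity clause from (III.6)–(III.7) -/

/-- The one-loop value of the leading `A⁴/24` coefficient in the units of (III.6) p.352: `lnEtaCoeff(t)·|ln η| + F(η)`, where
`lnEtaCoeff t = 9/8(1 + t/2 + 5t²/12)` (`t = 1/ζ − 1`; the tree's `OneLoop.lnEtaCoeff`, `OneLoop.lnEtaCoeff_eq`), `|ln η| = −log η` for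
`0 < η < 1`, and `F` = the «finite terms» («uniformly bounded both as ρ tends to +∞ and η tends to 0», p.352 tl.6–7).
[cite: MagnenRivasseauSeneor1993, §III (III.6) p.352] -/
def oneLoopA4Coeff (t : ℝ) (F : ℝ → ℝ) (η : ℝ) : ℝ :=
  OneLoop.lnEtaCoeff t * (-Real.log η) + F η

/-- For bounded finite terms `|F(η)| ≤ C` and `0 < η ≤ exp(−160C/73)`, `η < 1`, the one-loop coefficient is `> 0` (indeed `≥ ½|ln η|`,
`OneLoop.stabilizing_coefficient_ge_half_log`). [cite: MagnenRivasseauSeneor1993, §III (III.6)–(III.7) p.352] -/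
theorem oneLoopA4Coeff_pos (t : ℝ) {F : ℝ → ℝ} {C η : ℝ} (hF : |F η| ≤ C) (hη : 0 < η) (hη1 : η < 1)
    (hsmall : η ≤ Real.exp (-(160 * C / 73))) : 0 < oneLoopA4Coeff t F η := by
  have h := OneLoop.stabilizing_coefficient_ge_half_log t hF hη hsmall
  have hlog : 0 < -Real.log η := by
    have := Real.log_neg hη hη1
    linarith
  unfold oneLoopA4Coeff
  linarith

/-- **The printed positivity clause of Lemma III.1 holds for the one-loop coefficient** as soon as the finite terms are bounded near
`η = 0`: if `|F(η)| ≤ C` for `0 < η ≤ η₁`, then `LemmaIII1PositivityPrinted (oneLoopA4Coeff t F)` with the explicit threshold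
`η₀ = min(η₁, ½, exp(−160C/73))` — «with η small enough (depending on the shape of τ)»: the shape enters through `C` and `η₁`.
[cite: MagnenRivasseauSeneor1993, §III Lemma III.1 p.348, (III.6)–(III.7) p.352] -/
theorem positivity_of_boundedFiniteTerms (t : ℝ) {F : ℝ → ℝ} {C η₁ : ℝ} (hη₁ : 0 < η₁)
    (hF : ∀ η : ℝ, 0 < η → η ≤ η₁ → |F η| ≤ C) :
    LemmaIII1PositivityPrinted (oneLoopA4Coeff t F) := by
  refine ⟨min η₁ (min (1 / 2) (Real.exp (-(160 * C / 73)))), ?_, ?_⟩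
  · exact lt_min hη₁ (lt_min (by norm_num) (Real.exp_pos _))
  · intro η hη hle
    have h1 : η ≤ η₁ := hle.trans (min_le_left _ _)
    have h2 : η ≤ 1 / 2 := hle.trans ((min_le_right _ _).trans (min_le_left _ _))
    have h3 : η ≤ Real.exp (-(160 * C / 73)) := hle.trans ((min_le_right _ _).trans (min_le_right _ _))
    exact oneLoopA4Coeff_pos t (hF η hη h1) hη (by linarith) h3

/-- And the coefficient is not merely positive but «as large as we want, if η is small enough» (p.352 tl.14–15): for every `K ≥ 0`,
bounded finite terms give `oneLoopA4Coeff ≥ K` below an explicit threshold (`OneLoop.stabilizing_coefficient_large`).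
[cite: MagnenRivasseauSeneor1993, §III p.352] -/
theorem oneLoopA4Coeff_large (t : ℝ) {F : ℝ → ℝ} {C K η : ℝ} (hF : |F η| ≤ C) (hK : 0 ≤ K) (hη : 0 < η)
    (hsmall : η ≤ Real.exp (-((K + C) * 160 / 153))) : K ≤ oneLoopA4Coeff t F η :=
  OneLoop.stabilizing_coefficient_large t hF hK hη hsmall

end Counterterms

end Literature.MathematicalPhysics.QuantumFieldTheory.MagnenRivasseauSeneor1993
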